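import Summits.ABC.ABC.Theorems.IsogenyGlueCongruenceModularJacobianMultipliersOfFacts
import Summits.ABC.ABC.Theorems.IsogenyGlueCongruenceModularDatumExists
import HarnessLib

/-!
# Route IsogenyGlueCongruence, item `ModularJacobianMultipliers` (stmt-ABC-13920): closed form over
# the route item `ModularDatumExists`

Since rev 11 of the route file the modularity input of this route is itself a route ITEM,
`Summit.ABC.ABC.Theses.IsogenyGlueCongruence.ModularDatumExists` (stmt-ABC-15126; verbatim the named
fact `nonempty_modularParametrizationData`, and unconditionally equivalent to the Modularity Theorem
`exists_isNewformOf`, `modularDatumExists_iff_exists_isNewformOf`). The two other fact-shaped supports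
of the `U`-line were re-based on it (`SemistableHeightPolyBoundOfMazurKenku`,
`DegreePrimeCongruenceOfMazurKenku`, both proved). This file does the same for
`ModularJacobianMultipliers`:

* `modularJacobianMultipliers_of_modularDatumExists` —
  `ModularDatumExists → exists_modularJacobian_hom_generators → ModularJacobianMultipliers`: the item
  from the route item stmt-ABC-15126 and the ONE remaining Literature named fact, the modular Jacobian
  `J₀(N)` with multiplicity one (`exists_modularJacobian_hom_generators`: Shimura 1971 Thm. 7.14,
  Agashe–Ribet–Stein 2012 §2.1 and §3). One line over `modularJacobianMultipliers_of_facts`.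
* `modularJacobianMultipliers_iff_modularDatumExists_semistable` — given the Jacobian fact, the item
  is EQUIVALENT to the semistable slice of `ModularDatumExists` (a datum at level `N_W` for every
  semistable globally minimal `W`), i.e. to Wiles 1995 Thm. 0.4 in datum form: the exact residual.

So the item is closed modulo {stmt-ABC-15126 (semistable slice), `exists_modularJacobian_hom_generators`},
and a glue item `ModularDatumExists → exists_modularJacobian_hom_generators → ModularJacobianMultipliers`
would close by `exact modularJacobianMultipliers_of_modularDatumExists`.

## References

* G. Shimura, *Introduction to the arithmetic theory of automorphic functions* (1971): Thm. 7.14.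
  [ShimuraIATAF1971]
* A. Agashe, K. Ribet, W. Stein, *The modular degree, congruence primes, and multiplicity one*
  (2012), §2.1, §3. [AgasheRibetStein2012]
* A. Wiles, *Modular elliptic curves and Fermat's Last Theorem*, Ann. of Math. 141 (1995), Thm. 0.4.
  [Wiles1995]
* C. Breuil, B. Conrad, F. Diamond, R. Taylor, J. Amer. Math. Soc. 14 (2001), Thm. A. [BCDTJAMS2001]
-/

-- `Summit.<Summit>.<Problem>` is the mandated summit-side namespace (CONVENTIONS §2); for the
-- single-conjunct summit `ABC` the two coincide, so the duplicate `ABC.ABC` is deliberate.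
set_option linter.dupNamespace false

noncomputable section

open CategoryTheory
open Literature.NumberTheory.EllipticCurves.ModularForms
open Literature.NumberTheory.Automorphic
open Literature.AlgebraicGeometry.Motives

namespace Summit.ABC.ABC.Theorems

/-- **`ModularJacobianMultipliers` from the route item `ModularDatumExists` and the modular-Jacobian
fact.** `ModularDatumExists` (stmt-ABC-15126) is the Modularity Theorem in datum form
(`modularDatumExists_iff_exists_isNewformOf`, unconditional), and
`modularJacobianMultipliers_of_facts` takes it from there together with
`exists_modularJacobian_hom_generators` (`J₀(N)` as an abelian variety over `ℚ` of dimension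
`g(X₀(N)) ≤ N²`, `Hom(E, J₀(N)) = ℤι`, `Hom(J₀(N), E) = ℤπ`, `ι ≫ π = [deg_min]`; Shimura 1971
Thm. 7.14, Agashe–Ribet–Stein 2012 §2.1, §3). -/
theorem modularJacobianMultipliers_of_modularDatumExists
    (hM : Summit.ABC.ABC.Theses.IsogenyGlueCongruence.ModularDatumExists)
    (hJ : exists_modularJacobian_hom_generators) :
    Summit.ABC.ABC.Theses.IsogenyGlueCongruence.ModularJacobianMultipliers :=
  modularJacobianMultipliers_of_facts (modularDatumExists_iff_exists_isNewformOf.mp hM) hJ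

/-- **Given the modular-Jacobian fact, `ModularJacobianMultipliers` is EQUIVALENT to the semistable
slice of `ModularDatumExists`** — a modular parametrisation datum at level `N_W` for every
semistable elliptic `W/ℚ` in a globally minimal model (Wiles 1995, Thm. 0.4, in the datum form (6)
of BCDT 2001, p. 845). (→) the item's own datum; (←) per curve a datum is exactly modularity of that
curve (`nonempty_modularParametrizationData_iff_isModular`, unconditional), and
`modularJacobianMultipliers_iff_of_jacobian` turns semistable modularity into the item. This is
the exact residual of the item beyond `J₀(N)`. -/
theorem modularJacobianMultipliers_iff_modularDatumExists_semistable
    (hJ : exists_modularJacobian_hom_generators) :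
    Summit.ABC.ABC.Theses.IsogenyGlueCongruence.ModularJacobianMultipliers ↔
      ∀ (W : WeierstrassCurve ℚ) [W.IsElliptic] [W.IsGloballyMinimal]
        [NeZero (W.conductorNorm ℤ)], W.IsSemistable ℤ →
          Nonempty (ModularParametrizationData W (W.conductorNorm ℤ)) := by
  refine ⟨fun h W _ _ _ hW ↦ ?_, fun h ↦ (modularJacobianMultipliers_iff_of_jacobian hJ).mpr
    fun W _ _ _ hW ↦ (nonempty_modularParametrizationData_iff_isModular W).mp (h W hW)⟩
  obtain ⟨D, -⟩ := h W hW
  exact ⟨D⟩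

end Summit.ABC.ABC.Theorems

end
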